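import Summits.BirchSwinnertonDyer.BirchSwinnertonDyer.Theorems.KolyvaginRoadThreeMethod2KolyvaginTransverseIsotropy
import Literature.NumberTheory.GaloisRepresentations.DecompositionGroupRelSlim
import Literature.NumberTheory.GaloisRepresentations.FrobeniusGeneration
import Literature.NumberTheory.GaloisRepresentations.ContinuousCupProductCompat
import HarnessLib

/-!
# KOLY method line, crux stmt-BirchSwinnertonDyer-19574 `ZhangSharpFrameAtThreeHL`, stub S2-ENGINE: COCYCLE TOOLS FOR (Perf) —
# symmetric `2`-cocycles at odd exponent, and the decomposition group `Γ_{K_v} ⥲ G_𝔓` in cocycle currency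
# (cell `bsd-stepL`, seat `bsd-stepL-zhang3-p1` g9; `--supports 19574`, helper)

Tools for the binder (Perf) `hperf` of `Method2.triangulation_of_kolyvaginLocal` (p508963) — the non-degeneracy of the
local Weil cup product between the unramified and the transverse eigen-lines at a Kolyvagin prime `λ`, proved
structurally (no evaluation formula; sequel `…KolyvaginPerfLocal`, `…KolyvaginPerf`).

* §1 `twoCocycleClass_eq_zero_of_symmetric` — a continuous `2`-cocycle of the shape `(σ, τ) ↦ B(f σ, f τ)` with `f`
  additive, `B` symmetric on the values of `f`, `3 · B = 0` there and `G`-fixed values, is a coboundary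
  (`b(σ) = B(f σ, f σ)`; `-2 ≡ 1 mod 3`) — the odd-exponent symmetric-cocycle trick (Mazur–Rubin 2004, proof of Prop. 1.3.2).
* §2 at a finite place `v` of a number field `K`, `𝔓 ∣ v` the prime of `\bar ℤ_K` cut out by the chosen embedding
  `K̄ → \bar{K_v}`: every element of `G_𝔓` lifts to `Γ_{K_v}` (`exists_absGaloisRestrict_eq_of_mem_decompositionSubgroup`),
  continuously and multiplicatively (`exists_continuous_lift_decompositionSubgroup`: `res` is an injective closed embedding of
  the compact `Γ_{K_v}`, Neukirch II (9.6)); an open neighbourhood of `1` in `Γ_{K_v}` contains the preimage of an open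
  subgroup of `Γ_K` (`exists_isOpen_subgroup_absGaloisRestrict_mem`, Krull topology); and **an additive continuous
  `θ : Γ_{K_v} → M` killing the preimage of the inertia group is determined by its value at a Frobenius lift**
  (`exists_apply_eq_nsmul_apply_of_unramified`, from `G_𝔓 = ⟨φ⟩ · I_𝔓 · U`, tree
  `exists_eq_frobenius_pow_mul_of_mem_decompositionSubgroup`).

References: B. Mazur, K. Rubin, Mem. AMS 799 (2004), Prop. 1.3.2; J. Neukirch, *Algebraic Number Theory*, II (9.6), I (9.4).
-/

noncomputable section

open scoped Classical Pointwise

/-! ## §1 Symmetric rank-one `2`-cocycles at odd exponent are coboundaries -/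

namespace Literature.NumberTheory.GaloisRepresentations

universe u v

/-- **A symmetric bi-additive `2`-cocycle of exponent `3` is a coboundary.** Let `f : G → M` be continuous and additive,
`B : M → M → Z` bi-additive with `B(f σ, f τ) = B(f τ, f σ)`, `3 · B(f σ, f τ) = 0` and `B(f σ, f τ)` fixed by `G`. Then the
continuous `2`-cocycle `(σ, τ) ↦ B(f σ, f τ)` is the coboundary of `b(σ) = B(f σ, f σ)`:
`b τ - b (στ) + b σ = -2 B(f σ, f τ) = B(f σ, f τ)`. (Mazur–Rubin 2004, proof of Prop. 1.3.2: "the cup product … is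
symmetric, hence — `p` being odd — a coboundary".) [cite: MazurRubin2004, Prop. 1.3.2 (proof)] -/
theorem twoCocycleClass_eq_zero_of_symmetric {R : Type u} [CommRing R] [TopologicalSpace R]
    {G : Type v} [Group G] [TopologicalSpace G] [IsTopologicalGroup G] [LocallyCompactSpace G] (Z : TopRep.{v} R G)
    {M : Type*} [AddCommGroup M] [TopologicalSpace M] [DiscreteTopology M]
    (f : C(G, M)) (hf : ∀ σ τ, f (σ * τ) = f σ + f τ) (B : M → M → Z)
    (hB₁ : ∀ a a' b, B (a + a') b = B a b + B a' b) (hB₂ : ∀ a b b', B a (b + b') = B a b + B a b')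
    (hsymm : ∀ σ τ, B (f σ) (f τ) = B (f τ) (f σ)) (h3 : ∀ σ τ, (3 : ℕ) • B (f σ) (f τ) = 0)
    (hfix : ∀ g σ τ, Z.ρ g (B (f σ) (f τ)) = B (f σ) (f τ))
    (c : contTwoCocycles Z) (hc : ∀ σ τ, c.1 (σ, τ) = B (f σ) (f τ)) : twoCocycleClass Z c = 0 := by
  rw [twoCocycleClass_eq_zero_iff]
  refine ⟨⟨fun σ ↦ B (f σ) (f σ), (continuous_of_discreteTopology (f := fun m : M ↦ B m m)).comp f.continuous⟩,
    fun σ τ ↦ ?_⟩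
  change c.1 (σ, τ) = Z.ρ σ (B (f τ) (f τ)) - B (f (σ * τ)) (f (σ * τ)) + B (f σ) (f σ)
  rw [hc, hfix, hf]
  simp only [hB₁, hB₂]
  rw [hsymm τ σ]
  have h0 : B (f σ) (f τ) + (B (f σ) (f τ) + B (f σ) (f τ)) = 0 := by
    rw [← h3 σ τ]; abel
  rw [← sub_eq_zero]
  calc _ = B (f σ) (f τ) + (B (f σ) (f τ) + B (f σ) (f τ)) := by abel
    _ = 0 := h0

end Literature.NumberTheory.GaloisRepresentations

/-! ## §2 The decomposition group `Γ_{K_v} ⥲ G_𝔓` -/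

namespace Summit.BirchSwinnertonDyer.Rank1Residual.X11b.Three.Koly.Method2.KolyLocal

open CategoryTheory WeierstrassCurve Field Function NumberField IsDedekindDomain
open Literature.NumberTheory.EllipticCurves Literature.NumberTheory.EllipticCurves.ModularForms
  Literature.NumberTheory.GaloisRepresentations Module
open Literature.NumberTheory.GaloisRepresentations.DiscreteGaloisModule (mu MuCarrier)
open Literature.NumberTheory.GaloisCohomology
open Summit.BirchSwinnertonDyer.Rank1Residual.X11b.Three.Koly.Method2
open Summit.BirchSwinnertonDyer.Rank1Residual.GaloisImage
open scoped ContRepresentation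

attribute [local instance] absoluteGaloisGroup_compactSpace
attribute [local instance] finite_geomTorsion_of_neZero

section Place

variable (K : Type) [Field K] [NumberField K] (v : HeightOneSpectrum (𝓞 K))

/-- **Every element of `G_𝔓` lifts to `Γ_{K_v}`** along `res : Γ_{K_v} → Γ_K`, for `𝔓` the prime of `\bar ℤ_K` cut out
by the chosen embedding `K̄ → \bar{K_v}` (the local–global principle for decomposition groups, Neukirch II (9.6); tree
`exists_apply_eq_smul_of_mem_decompositionSubgroup`). [cite: NeukirchANT1999, Ch. II §9 Prop. (9.6)] -/
theorem exists_absGaloisRestrict_eq_of_mem_decompositionSubgroup {𝔐 : Ideal (HeightOneSpectrum.localAbsIntegers v)}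
    (h𝔐 : 𝔐 ∈ v.localPrimesAbove) {d : absoluteGaloisGroup K}
    (hd : d ∈ (v.primeBelow (closureEmb (K := K) (v.adicCompletion K)) 𝔐).decompositionSubgroup (absoluteGaloisGroup K)) :
    ∃ g : absoluteGaloisGroup (v.adicCompletion K), absGaloisRestrict K (v.adicCompletion K) g = d := by
  obtain ⟨σ, hσ⟩ := exists_apply_eq_smul_of_mem_decompositionSubgroup (closureEmb (K := K) (v.adicCompletion K)) h𝔐 hd
  refine ⟨σ, ?_⟩
  rw [← resGal_eq_absGaloisRestrict, resGal_eq]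
  exact resGalOfEmb_eq_of_apply_eq _ hσ

/-- **An open neighbourhood of `1` in `Γ_{K_v}` contains the preimage of an open subgroup of `Γ_K`** (`res` is a closed
embedding of the compact `Γ_{K_v}` — Neukirch II (9.6) — and the open subgroups `Gal(K̄/E)`, `E/K` finite normal, form a
basis of neighbourhoods of `1` in the Krull topology). [cite: NeukirchANT1999, Ch. II §9 Prop. (9.6)] -/
theorem exists_isOpen_subgroup_absGaloisRestrict_mem {O : Set (absoluteGaloisGroup (v.adicCompletion K))} (hO : IsOpen O)
    (h1 : (1 : absoluteGaloisGroup (v.adicCompletion K)) ∈ O) :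
    ∃ U : Subgroup (absoluteGaloisGroup K), IsOpen (U : Set (absoluteGaloisGroup K)) ∧
      ∀ g, absGaloisRestrict K (v.adicCompletion K) g ∈ U → g ∈ O := by
  set res := absGaloisRestrict K (v.adicCompletion K) with hres
  have hinj : Injective res := absGaloisRestrict_adicCompletion_injective K v
  -- `res '' Oᶜ` is compact, hence closed, and misses `1`
  have hcl : IsClosed (res '' Oᶜ) := (hO.isClosed_compl.isCompact.image res.continuous_toFun).isClosed
  have h1' : (1 : absoluteGaloisGroup K) ∈ (res '' Oᶜ)ᶜ := by
    rintro ⟨g, hg, hg1⟩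
    apply hg
    have : g = 1 := hinj (by rw [hg1]; exact (map_one res).symm)
    rw [this]; exact h1
  obtain ⟨E, hEfd, -, hEt⟩ :=
    (krullTopology_mem_nhds_one_iff_of_normal K (AlgebraicClosure K) _).mp (hcl.isOpen_compl.mem_nhds h1')
  haveI := hEfd
  refine ⟨E.fixingSubgroup, E.fixingSubgroup_isOpen, fun g hg ↦ ?_⟩
  by_contra hgO
  exact hEt hg ⟨g, hgO, rfl⟩

/-- **A continuous section of `res : Γ_{K_v} ⥲ G_𝔓`**: there is a continuous multiplicative `L : G_𝔓 → Γ_{K_v}` with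
`res ∘ L = id` (`res` is injective with image `G_𝔓`, and a closed embedding of the compact `Γ_{K_v}`).
[cite: NeukirchANT1999, Ch. II §9 Prop. (9.6)] -/
theorem exists_continuous_lift_decompositionSubgroup {𝔐 : Ideal (HeightOneSpectrum.localAbsIntegers v)}
    (h𝔐 : 𝔐 ∈ v.localPrimesAbove) :
    ∃ L : (v.primeBelow (closureEmb (K := K) (v.adicCompletion K)) 𝔐).decompositionSubgroup (absoluteGaloisGroup K) →
        absoluteGaloisGroup (v.adicCompletion K),
      Continuous L ∧ (∀ d, absGaloisRestrict K (v.adicCompletion K) (L d) = d) ∧ ∀ d d', L (d * d') = L d * L d' := by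
  have hinj : Injective (absGaloisRestrict K (v.adicCompletion K)) := absGaloisRestrict_adicCompletion_injective K v
  choose L hL using fun d : (v.primeBelow (closureEmb (K := K) (v.adicCompletion K)) 𝔐).decompositionSubgroup
    (absoluteGaloisGroup K) ↦ exists_absGaloisRestrict_eq_of_mem_decompositionSubgroup K v h𝔐 d.2
  have hemb : Topology.IsClosedEmbedding (absGaloisRestrict K (v.adicCompletion K)) :=
    Continuous.isClosedEmbedding (absGaloisRestrict K (v.adicCompletion K)).continuous_toFun hinj
  refine ⟨L, ?_, hL, fun d d' ↦ hinj ?_⟩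
  · refine hemb.isEmbedding.continuous_iff.mpr ?_
    have : (⇑(absGaloisRestrict K (v.adicCompletion K)) ∘ L) =
        ⇑((v.primeBelow (closureEmb (K := K) (v.adicCompletion K)) 𝔐).decompositionSubgroup (absoluteGaloisGroup K)).subtype :=
      funext fun d ↦ hL d
    rw [this]
    exact continuous_subtype_val
  · rw [map_mul, hL, hL, hL, Subgroup.coe_mul]

/-- **An unramified additive continuous function on `Γ_{K_v}` is determined by its value at a Frobenius lift**:
if `θ : Γ_{K_v} → M` (discrete `M`) is continuous and additive, kills every `g` with `res g ∈ I_𝔓`, and `g_F` lifts an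
arithmetic Frobenius `F` at `𝔓`, then `θ g ∈ ℕ · θ g_F` for every `g` (`G_𝔓 = ⟨F⟩ · I_𝔓 · U` for every open
subgroup `U`, Neukirch I (9.4); the preimage of a suitable `U` lies in `ker θ`). [cite: NeukirchANT1999, I §9 Prop. (9.4)] -/
theorem exists_apply_eq_nsmul_apply_of_unramified {𝔐 : Ideal (HeightOneSpectrum.localAbsIntegers v)}
    (h𝔐 : 𝔐 ∈ v.localPrimesAbove) {M : Type*} [AddCommGroup M] [TopologicalSpace M] [DiscreteTopology M]
    (θ : C(absoluteGaloisGroup (v.adicCompletion K), M)) (hθ : ∀ g h, θ (g * h) = θ g + θ h)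
    (hI : ∀ g, absGaloisRestrict K (v.adicCompletion K) g ∈
      (v.primeBelow (closureEmb (K := K) (v.adicCompletion K)) 𝔐).inertia (absoluteGaloisGroup K) → θ g = 0)
    {F : absoluteGaloisGroup K}
    (hF : IsArithFrobAt (𝓞 K) F (v.primeBelow (closureEmb (K := K) (v.adicCompletion K)) 𝔐))
    {gF : absoluteGaloisGroup (v.adicCompletion K)} (hgF : absGaloisRestrict K (v.adicCompletion K) gF = F)
    (g : absoluteGaloisGroup (v.adicCompletion K)) : ∃ k : ℕ, θ g = k • θ gF := by
  set res := absGaloisRestrict K (v.adicCompletion K) with hres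
  set ι₀ := closureEmb (K := K) (v.adicCompletion K) with hι₀
  have hinj : Injective res := absGaloisRestrict_adicCompletion_injective K v
  have h𝔓 : v.primeBelow ι₀ 𝔐 ∈ v.primesAbove := HeightOneSpectrum.primeBelow_mem_primesAbove h𝔐
  -- an open subgroup `U ≤ Γ_K` with `res⁻¹ U ⊆ ker θ`
  have hO : IsOpen {g : absoluteGaloisGroup (v.adicCompletion K) | θ g = 0} :=
    (isOpen_discrete ({0} : Set M)).preimage θ.continuous
  have h10 : θ 1 = 0 := by
    have h := hθ 1 1
    rw [mul_one] at h
    exact left_eq_add.mp h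
  obtain ⟨U, hU, hUθ⟩ := exists_isOpen_subgroup_absGaloisRestrict_mem K v hO h10
  -- `res g ∈ G_𝔓 = ⟨F⟩ I U`
  have hd : res g ∈ (v.primeBelow ι₀ 𝔐).decompositionSubgroup (absoluteGaloisGroup K) := by
    rw [hres, ← resGal_eq_absGaloisRestrict, resGal_eq]; exact resGalOfEmb_mem_decompositionSubgroup ι₀ h𝔐 g
  obtain ⟨k, i, u, hi, hu, hdec⟩ := exists_eq_frobenius_pow_mul_of_mem_decompositionSubgroup h𝔓 hF hU hd
  -- lift `i`; then `g = gF ^ k * gi * gu` with `res gu = u`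
  have hiD : i ∈ (v.primeBelow ι₀ 𝔐).decompositionSubgroup (absoluteGaloisGroup K) := Ideal.inertia_le_stabilizer _ hi
  obtain ⟨gi, hgi⟩ := exists_absGaloisRestrict_eq_of_mem_decompositionSubgroup K v h𝔐 hiD
  set gu := (gF ^ k * gi)⁻¹ * g with hgu
  have hgu' : res gu = u := by
    rw [hgu, map_mul, map_inv, map_mul, map_pow, hgF, hgi, hdec, inv_mul_cancel_left]
  have hg : g = gF ^ k * gi * gu := by rw [hgu, mul_inv_cancel_left]
  have hpow : ∀ m : ℕ, θ (gF ^ m) = m • θ gF := fun m ↦ by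
    induction m with
    | zero => rw [pow_zero, h10, zero_smul]
    | succ m ih => rw [pow_succ gF m, hθ, ih, succ_nsmul]
  have hθi : θ gi = 0 := hI gi (by rw [hgi]; exact hi)
  have hθu : θ gu = 0 := hUθ gu (hgu' ▸ hu)
  refine ⟨k, ?_⟩
  rw [hg, hθ, hθ, hpow, hθi, hθu, add_zero, add_zero]

end Place

end Summit.BirchSwinnertonDyer.Rank1Residual.X11b.Three.Koly.Method2.KolyLocal

end
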